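import Mathlib
import Summits.KontsevichZagierPeriods.KontsevichZagierPeriods.Theorems.SoloInformedBandGerm
import HarnessLib
import HarnessLib.Audit

/-!
# SoloInformed — the BAND LEMMA (PRES-RAT(2), Phase III-3b)

Solo programme `solo-KontsevichZagierPeriods-informed`, session s110.  **BAND LEMMA.**  Let
`d : SoloInformedBandData` (boundary germs `A`, `B` analytic near `[0,1]` and real on reals, an
integrand germ `F` analytic near the straightened closed square, algebraic composite) with
`a = Re A < b = Re B` on the OPEN interval `(0,1)` and `a`, `b` `ℚ`-semialgebraic there.  Then
every integral representation `r = [Ω, f]` in dimension `2` with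
`Ω = {(x, y) | 0 < x < 1, a(x) < y < b(x)}` (the band) and `f = F` on `Ω` is PRESENTABLE
(`of r ∈ soloInformedPresentable`): the straightening `Φ(s,t) = (s, a(s) + t (b(s) − a(s)))` is an
injective `ℚ`-semialgebraic `C¹` map of the open square onto the band with Jacobian `b − a > 0`,
and `f ∘ Φ · |det Φ'|` is the real part of the band germ (`SoloInformedBandData.germ`), so the
Nash-image lemma `soloInformed_presentable_of_nashImage` applies.  Degenerate ends
(`a(0) = b(0)` or `a(1) = b(1)`) are allowed.  This is the leaf of the PRES-RAT(2) recursion: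
after the vertical-strip / blow-up reduction every piece of a planar `ℚ`-semialgebraic domain with
rational integrand is such a band (up to an affine `K`-chart).

References: Kontsevich–Zagier 2001 §1.2 (rule (2)); Bochnak–Coste–Roy 1998 §2.2, §2.9;
Viu-Sos 2021 §2.3 (semi-canonical reduction, planar case); folklore.
-/

noncomputable section

open scoped BigOperators Topology
open MeasureTheory Set Filter Metric
open Literature.NumberTheory.Transcendental Literature.NumberTheory.Transcendental.KZ
open Literature.ModelTheory.ExponentialFields (IsSemialgebraic)

namespace Summit.KontsevichZagierPeriods.KontsevichZagierPeriods.Theorems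

/-! ### The real straightening map and its derivative -/

/-- The band straightening `Φ(s, t) = (s, a(s) + t (b(s) − a(s)))`. [this work] -/
def soloInformedBandMap (a b : ℝ → ℝ) (x : Fin 2 → ℝ) : Fin 2 → ℝ :=
  ![x 0, a (x 0) + x 1 * (b (x 0) - a (x 0))]

/-- The Jacobian matrix of the straightening, `[[1, 0], [a' + t (b' − a'), b − a]]`, as a
continuous linear map. [this work] -/
def soloInformedBandDeriv (a b a' b' : ℝ → ℝ) (x : Fin 2 → ℝ) : (Fin 2 → ℝ) →L[ℝ] (Fin 2 → ℝ) :=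
  LinearMap.toContinuousLinearMap
    (Matrix.toLin' !![1, 0; a' (x 0) + x 1 * (b' (x 0) - a' (x 0)), b (x 0) - a (x 0)])

/-- Components of the straightening. -/
@[simp] theorem soloInformedBandMap_apply_zero (a b : ℝ → ℝ) (x : Fin 2 → ℝ) :
    soloInformedBandMap a b x 0 = x 0 := rfl

/-- Components of the straightening. -/
@[simp] theorem soloInformedBandMap_apply_one (a b : ℝ → ℝ) (x : Fin 2 → ℝ) :
    soloInformedBandMap a b x 1 = a (x 0) + x 1 * (b (x 0) - a (x 0)) := rfl

/-- The Jacobian applied to a vector. -/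
theorem soloInformedBandDeriv_apply (a b a' b' : ℝ → ℝ) (x v : Fin 2 → ℝ) :
    soloInformedBandDeriv a b a' b' x v =
      ![v 0, (a' (x 0) + x 1 * (b' (x 0) - a' (x 0))) * v 0 + (b (x 0) - a (x 0)) * v 1] := by
  funext i
  fin_cases i <;>
    simp [soloInformedBandDeriv, Matrix.toLin'_apply, Matrix.mulVec, dotProduct, Fin.sum_univ_two]

/-- **The Jacobian determinant is `b − a`.** -/
theorem soloInformed_det_bandDeriv (a b a' b' : ℝ → ℝ) (x : Fin 2 → ℝ) :
    (soloInformedBandDeriv a b a' b' x).det = b (x 0) - a (x 0) := by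
  simp only [soloInformedBandDeriv, ContinuousLinearMap.det, LinearMap.coe_toContinuousLinearMap,
    LinearMap.det_toLin', Matrix.det_fin_two_of]
  ring

/-- **Differentiability of the straightening** with the stated Jacobian. -/
theorem soloInformed_hasFDerivAt_bandMap {a b a' b' : ℝ → ℝ} {x : Fin 2 → ℝ}
    (ha : HasDerivAt a (a' (x 0)) (x 0)) (hb : HasDerivAt b (b' (x 0)) (x 0)) :
    HasFDerivAt (soloInformedBandMap a b) (soloInformedBandDeriv a b a' b' x) x := by
  have h0 : HasFDerivAt (fun x : Fin 2 → ℝ => x 0)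
      (ContinuousLinearMap.proj (R := ℝ) (φ := fun _ : Fin 2 => ℝ) 0) x :=
    hasFDerivAt_apply (𝕜 := ℝ) 0 x
  have h1 : HasFDerivAt (fun x : Fin 2 → ℝ => x 1)
      (ContinuousLinearMap.proj (R := ℝ) (φ := fun _ : Fin 2 => ℝ) 1) x :=
    hasFDerivAt_apply (𝕜 := ℝ) 1 x
  have ha' : HasFDerivAt (fun x : Fin 2 → ℝ => a (x 0))
      (a' (x 0) • ContinuousLinearMap.proj (R := ℝ) (φ := fun _ : Fin 2 => ℝ) 0) x :=
    HasDerivAt.comp_hasFDerivAt (h₂ := a) (f := fun x : Fin 2 → ℝ => x 0) x ha h0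
  have hb' : HasFDerivAt (fun x : Fin 2 → ℝ => b (x 0))
      (b' (x 0) • ContinuousLinearMap.proj (R := ℝ) (φ := fun _ : Fin 2 => ℝ) 0) x :=
    HasDerivAt.comp_hasFDerivAt (h₂ := b) (f := fun x : Fin 2 → ℝ => x 0) x hb h0
  have h2 := ha'.fun_add (h1.fun_mul (hb'.fun_sub ha'))
  refine hasFDerivAt_pi'' fun i => ?_
  fin_cases i
  · refine h0.congr_fderiv ?_
    ext v
    simp [soloInformedBandDeriv_apply]
  · refine h2.congr_fderiv ?_
    ext v
    simp [soloInformedBandDeriv_apply]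
    ring

/-- **Injectivity** of the straightening where `a < b`. -/
theorem soloInformed_injOn_bandMap {a b : ℝ → ℝ} {s : Set (Fin 2 → ℝ)}
    (hlt : ∀ x ∈ s, a (x 0) < b (x 0)) : InjOn (soloInformedBandMap a b) s := by
  intro x hx y hy hxy
  have h0 : x 0 = y 0 := by
    have := congrFun hxy 0
    simpa using this
  have h1 := congrFun hxy 1
  simp only [soloInformedBandMap_apply_one] at h1
  rw [← h0] at h1
  have hba : 0 < b (x 0) - a (x 0) := sub_pos.2 (hlt x hx)
  have h1' : x 1 = y 1 := by
    have : x 1 * (b (x 0) - a (x 0)) = y 1 * (b (x 0) - a (x 0)) := by linarith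
    exact mul_right_cancel₀ hba.ne' this
  funext i
  fin_cases i
  · exact h0
  · exact h1'

/-- The band between `a` and `b` over the open unit interval. [this work] -/
def soloInformedBand (a b : ℝ → ℝ) : Set (Fin 2 → ℝ) :=
  {y | 0 < y 0 ∧ y 0 < 1 ∧ a (y 0) < y 1 ∧ y 1 < b (y 0)}

/-- **The straightening maps the open square onto the band.** -/
theorem soloInformed_bandMap_image {a b : ℝ → ℝ}
    (hlt : ∀ s : ℝ, 0 < s → s < 1 → a s < b s) :
    soloInformedBandMap a b '' soloInformedOpenCube 2 = soloInformedBand a b := by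
  ext y
  constructor
  · rintro ⟨x, hx, rfl⟩
    have h0 := hx 0
    have h1 := hx 1
    have hba : 0 < b (x 0) - a (x 0) := sub_pos.2 (hlt _ h0.1 h0.2)
    refine ⟨h0.1, h0.2, ?_, ?_⟩
    · simp only [soloInformedBandMap_apply_zero, soloInformedBandMap_apply_one]
      nlinarith [h1.1]
    · simp only [soloInformedBandMap_apply_zero, soloInformedBandMap_apply_one]
      nlinarith [h1.2]
  · rintro ⟨h0, h1, ha, hb⟩
    have hba : 0 < b (y 0) - a (y 0) := by linarith
    refine ⟨![y 0, (y 1 - a (y 0)) / (b (y 0) - a (y 0))], ?_, ?_⟩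
    · intro j
      fin_cases j
      · exact ⟨by simpa using h0, by simpa using h1⟩
      · refine ⟨?_, ?_⟩
        · simp only [Fin.mk_one, Fin.isValue, Matrix.cons_val_one, Matrix.cons_val_fin_one]
          exact div_pos (by linarith) hba
        · simp only [Fin.mk_one, Fin.isValue, Matrix.cons_val_one, Matrix.cons_val_fin_one]
          rw [div_lt_one hba]
          linarith
    · funext i
      fin_cases i
      · simp [soloInformedBandMap]
      · simp only [soloInformedBandMap, Fin.mk_one, Fin.isValue, Matrix.cons_val_one,
          Matrix.cons_val_fin_one, Matrix.cons_val_zero]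
        field_simp
        ring

/-- The projection `(s, t) ↦ s` from the open square to the open interval is `ℚ`-semialgebraic. -/
theorem soloInformed_isSemialgebraicMapOn_fst :
    IsSemialgebraicMapOn ℚ (soloInformedOpenCube 2) (fun x : Fin 2 → ℝ => fun _ : Fin 1 => x 0) := by
  refine IsSemialgebraicMapOn.of_forall (isSemialgebraic_soloInformedOpenCube 2) fun j => ?_
  have h := isSemialgebraicFunOn_aeval (R := ℝ) (k := ℚ) (isSemialgebraic_soloInformedOpenCube 2)
    (MvPolynomial.X 0)
  exact h.congr fun x _ => by simp

/-- A `ℚ`-semialgebraic function of `s ∈ (0,1)` is a `ℚ`-semialgebraic function of `(s, t)` on the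
open square. -/
theorem soloInformed_isSemialgebraicFunOn_comp_fst {c : ℝ → ℝ}
    (hc : IsSemialgebraicFunOn ℚ (soloInformedOpenCube 1) (fun x => c (x 0))) :
    IsSemialgebraicFunOn ℚ (soloInformedOpenCube 2) (fun x => c (x 0)) := by
  have hm : MapsTo (fun x : Fin 2 → ℝ => fun _ : Fin 1 => x 0) (soloInformedOpenCube 2)
      (soloInformedOpenCube 1) := fun x hx _ => hx 0
  have h := IsSemialgebraicFunOn.comp_isSemialgebraicMapOn_holds hc
    soloInformed_isSemialgebraicMapOn_fst hm
  exact h.congr fun x _ => rfl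

/-- **Semialgebraicity of the straightening** on the open square. -/
theorem soloInformed_isSemialgebraicMapOn_bandMap {a b : ℝ → ℝ}
    (ha : IsSemialgebraicFunOn ℚ (soloInformedOpenCube 1) (fun x => a (x 0)))
    (hb : IsSemialgebraicFunOn ℚ (soloInformedOpenCube 1) (fun x => b (x 0))) :
    IsSemialgebraicMapOn ℚ (soloInformedOpenCube 2) (soloInformedBandMap a b) := by
  have hs := isSemialgebraic_soloInformedOpenCube 2
  have ha2 := soloInformed_isSemialgebraicFunOn_comp_fst ha
  have hb2 := soloInformed_isSemialgebraicFunOn_comp_fst hb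
  have hX1 : IsSemialgebraicFunOn ℚ (soloInformedOpenCube 2) (fun x : Fin 2 → ℝ => x 1) :=
    (isSemialgebraicFunOn_aeval (R := ℝ) (k := ℚ) hs (MvPolynomial.X 1)).congr fun x _ => by simp
  refine IsSemialgebraicMapOn.of_forall hs fun j => ?_
  fin_cases j
  · exact (isSemialgebraicFunOn_aeval (R := ℝ) (k := ℚ) hs (MvPolynomial.X 0)).congr
      fun x _ => by simp
  · have h := IsSemialgebraicFunOn.add_holds ha2
      (IsSemialgebraicFunOn.mul_holds hX1 (IsSemialgebraicFunOn.sub_holds hb2 ha2))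
    exact h.congr fun x _ => by simp [soloInformedBandMap]

/-! ### The band lemma -/

namespace SoloInformedBandData

/-- The real lower boundary function `a = Re A`. [this work] -/
def a (d : SoloInformedBandData) (s : ℝ) : ℝ := (d.A s).re

/-- The real upper boundary function `b = Re B`. [this work] -/
def b (d : SoloInformedBandData) (s : ℝ) : ℝ := (d.B s).re

/-- `a` is differentiable on `[0,1]` with derivative `Re A'`. -/
theorem hasDerivAt_a (d : SoloInformedBandData) {s : ℝ} (hs : (s : ℂ) ∈ d.V) :
    HasDerivAt d.a (deriv d.A s).re s :=
  ((d.analyticA _ hs).differentiableAt.hasDerivAt).real_of_complex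

/-- `b` is differentiable on `[0,1]` with derivative `Re B'`. -/
theorem hasDerivAt_b (d : SoloInformedBandData) {s : ℝ} (hs : (s : ℂ) ∈ d.V) :
    HasDerivAt d.b (deriv d.B s).re s :=
  ((d.analyticB _ hs).differentiableAt.hasDerivAt).real_of_complex

/-- **BAND LEMMA.**  An integral representation whose domain is the band
`{0 < x < 1, a(x) < y < b(x)}` of band data with `a < b` on `(0,1)`, `a`, `b` `ℚ`-semialgebraic,
and whose integrand is (the real germ) `F` on the band, is presentable. [this work] -/
theorem presentable_band (d : SoloInformedBandData)
    (hlt : ∀ s : ℝ, 0 < s → s < 1 → d.a s < d.b s)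
    (has : IsSemialgebraicFunOn ℚ (soloInformedOpenCube 1) (fun x => d.a (x 0)))
    (hbs : IsSemialgebraicFunOn ℚ (soloInformedOpenCube 1) (fun x => d.b (x 0)))
    (r : IntegralRep 2) (hdom : r.domain = soloInformedBand d.a d.b)
    (hint : ∀ y ∈ r.domain, ((r.integrand y : ℝ) : ℂ) = d.F (soloInformedToC 2 y)) :
    of r ∈ soloInformedPresentable := by
  set a' : ℝ → ℝ := fun s => (deriv d.A s).re with ha'
  set b' : ℝ → ℝ := fun s => (deriv d.B s).re with hb'
  have hV : ∀ x ∈ soloInformedOpenCube 2, ((x 0 : ℝ) : ℂ) ∈ d.V := fun x hx =>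
    d.mem_V (x 0) ⟨(hx 0).1.le, (hx 0).2.le⟩
  refine soloInformed_presentable_of_nashImage r (soloInformedBandMap d.a d.b)
    (soloInformedBandDeriv d.a d.b a' b') d.germ
    (soloInformed_isSemialgebraicMapOn_bandMap has hbs) (fun x hx => ?_)
    (soloInformed_injOn_bandMap fun x hx => hlt _ (hx 0).1 (hx 0).2) ?_ (fun x hx => ?_)
  · -- differentiability
    exact (soloInformed_hasFDerivAt_bandMap (d.hasDerivAt_a (hV x hx))
      (d.hasDerivAt_b (hV x hx))).hasFDerivWithinAt
  · -- the domain
    rw [hdom, soloInformed_bandMap_image hlt]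
  · -- the integrand identity
    have hxc : x ∈ soloInformedCube 2 := soloInformedOpenCube_subset_cube 2 hx
    have hW := d.mem_W x hxc
    rw [d.germ_re x (hV x hx) hW, soloInformed_det_bandDeriv]
    have hpos : 0 < d.b (x 0) - d.a (x 0) := sub_pos.2 (hlt _ (hx 0).1 (hx 0).2)
    rw [abs_of_pos hpos]
    have hΦ : soloInformedBandMap d.a d.b x ∈ r.domain := by
      rw [hdom, ← soloInformed_bandMap_image hlt]
      exact mem_image_of_mem _ hx
    have hF := hint _ hΦ
    have hpt : soloInformedToC 2 ![x 0, (d.A (x 0)).re + x 1 * ((d.B (x 0)).re - (d.A (x 0)).re)] =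
        soloInformedToC 2 (soloInformedBandMap d.a d.b x) := rfl
    rw [hpt, ← hF, Complex.ofReal_re]
    rfl

end SoloInformedBandData

end Summit.KontsevichZagierPeriods.KontsevichZagierPeriods.Theorems
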